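import Literature.AnabelianGeometry.EtaleTheta.EtaleThetaClass
import HarnessLib

/-!
# [EtTh] §1: the PROFINITE theta quotient `((Π^tp_X)^Θ)^∧` and the profinite coverings `(Ÿ)^∧ → (Y)^∧ → X`
# of Remark 1.6.4 — a successor RECORD over `ThetaSetting` (RMK164-PROFINITE-TWIN, spec v2 D1/D2)

S. Mochizuki, *The Étale Theta Function and its Frobenioid-theoretic manifestations* [EtTh], Publ. RIMS **45**
(2009); locators `p.N` = PDF pages as in `Setting.lean` (PRIMS page = PDF page + 226).  p. 12 (PRIMS p. 238,
own render paper:doi-10-2977-prims-1234361159 p0012): "Write `Π_X = (Π^tp_X)^∧`; `Δ_X = (Δ^tp_X)^∧` [where the `∧` denotes the profinite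
completion]"; "we write `Δ^Θ_X = Δ_X/[Δ_X,[Δ_X,Δ_X]]`. Let us denote the image of `∧² Δ^ell_X` in `Δ^Θ_X` by
`(Ẑ(1) ≅) Δ_Θ ⊆ Δ^Θ_X`"; "we shall write `Π^tp_X ↠ (Π^tp_X)^Θ ↠ (Π^tp_X)^ell` for the quotients whose kernels are
the kernels of the quotients `Δ^tp_X ↠ (Δ^tp_X)^Θ ↠ (Δ^tp_X)^ell`" [cite: MochizukiEtTh2009, §1 p.12]; Remark 1.6.4,
p. 26 l. 22–33 (PRIMS p. 252): "One verifies immediately that there are [easier] profinite versions of the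
constructions given in the present §1: That is to say, if we denote by `(Ÿ^log)^∧ → (Y^log)^∧ → X^log` the profinite
étale coverings determined by the tempered coverings `Ÿ^log → Y^log → X^log` [so `Π_X/Π_{Y^∧} ≅ Ẑ`], then the set
of classes `O^×_K̈ · η̈^Θ ∈ H¹(Π^tp_Ÿ, Δ_Θ)` determines, by profinite completion, a set of classes
`O^×_K̈ · (η̈^Θ)^∧ ∈ H¹(Π_{Ÿ^∧}, Δ_Θ)`" [cite: MochizukiEtTh2009, Rmk 1.6.4 p.26].

DEFINITION file (cell abc-iut, layer L2; seat abc-iut-f-142 gen 8, row «RMK164-D1v2 HATTHETA RECORD» keyed by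
abc-iut-L2-lead gen 8 R1227 (iii); spec = abc-iut-f-128 gen 8 `RMK164-SPEC-v2-ThetaQuotientRoute-f128-g8.md`
bbed2a6ff5691db9 §D1/§D2; READING OF RECORD R1227: print's `Π_{Y^∧}`, `Π_{Ÿ^∧}` are the CLOSURES of `Π^tp_Y`,
`Π^tp_Ÿ` in `Π_X` — reading (a) — NOT intrinsic profinite completions).  abc-iut-L2-t1's frozen interface
`ThetaSetting` (`Setting.lean`) carries the TEMPERED theta quotient `(Π^tp_X)^Θ = GtpTheta` with
`toTheta : Π^tp_X ↠ (Π^tp_X)^Θ` and the coefficient group `Δ_Θ = DeltaTheta`, and abc-iut-L3's `TemperedCurve` carries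
the profinite completion `toHat : Π^tp_X → Π_X = PiHat`; it does NOT carry the PROFINITE theta quotient through which
`Π_X` — hence `Π_{Ÿ^∧}` — acts on `Δ_Θ` in Remark 1.6.4 (and `GtpTheta`'s topology is abstract, so no quotient of
`PiHat` can be proved to complete it).  This file packages that quotient as ONE successor record, in the style of the
cell's other origin/successor records (`PuncturedEllipticData.GeomOrigin`, `PointedInversion'`):

* `ThetaSetting.HatTheta D` — DATA `GhatTheta` (a profinite group, BUNDLED as a Mathlib `ProfiniteGrp` so that its
  group/topology/compactness instances come from Mathlib and NO instance is declared here — the pattern of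
  abc-iut-L4-t1's `FundamentalExtension`), `toThetaHat : Π_X → GhatTheta` with KERNEL `[Δ_X,[Δ_X,Δ_X]]⁻` (print's
  definition of the theta quotient, p. 12; compatible with the frozen `ThetaSetting.ker_toTheta`), `ι : (Π^tp_X)^Θ →
  GhatTheta` a profinite completion in abc-iut-L3's sense `IsProfiniteCompletion`, the SQUARE
  `ι ∘ toTheta = toThetaHat ∘ toHat`, and the closedness of `ι(Δ_Θ)` ("`(Ẑ(1) ≅) Δ_Θ`", already profinite);
  PROVED from these: `ι_injective`, `toThetaHat_surjective`, `comap_toHat_ker_toThetaHat`;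
* §1 (T-independent, `ThetaSetting` namespace): `GtpYddTheta = (Π^tp_Ÿ)^Θ`, `GtpYHat = Π_{Y^∧}`, `GtpYddHat = Π_{Ÿ^∧}`
  (CLOSURES, reading (a));
* §3 (D2 of the spec): `DeltaThetaHat = ι(Δ_Θ)`, `GhatThetaYdd = ((Π^tp_Ÿ)^Θ)^∧ :=` closure of `ι((Π^tp_Ÿ)^Θ)`, the
  co-restriction `ιYdd : (Π^tp_Ÿ)^Θ → GhatThetaYdd`, and the profinite cohomology groups `H1ThetaHat`, `H1Hat` with the
  inflation `inflThetaHat : H¹(GhatThetaYdd, Δ_Θ) → H¹(Π_{Ÿ^∧}, Δ_Θ)` over abc-iut-L2-t5's `ContH1` (the inclusion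
  `toThetaHat(Π_{Ÿ^∧}) ≤ GhatThetaYdd` is PROVED from the square);
* theorems: `deltaThetaHat_normal` (closed + normalised by the dense `ι((Π^tp_X)^Θ)`; a THEOREM — consumers write
  `haveI := T.deltaThetaHat_normal`, no instance is registered, typer lint rule), `ιYdd_apply`, `denseRange_ιYdd`.

HONEST FRAMING: a HYPOTHESIS / successor record ASSERTED FOR NO DATUM (its inhabitation at the models of record
modelχ / modelTate, which carry explicit `GtpTheta`, is a later proof-only file of their owners); the only displayed
input of the spec's comparison (D3 v2) is `IsProfiniteCompletion T.ιYdd`, supplied at compact `(Π^tp_Ÿ)^Θ` by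
abc-iut-f-128's «RMK164-IOTA-YDD-THETA» and NOT by any cofinality of `Π^tp_Ÿ ≤ Π^tp_X` (which fails in model shape:
abc-iut-w6-d081 p503294, abc-iut-f-127 p501630; criterion abc-iut-f-142 p501600).  No instance, no notation, no
`Prop`-valued fact; nothing of [EtTh] Remark 1.6.4 is asserted; nothing here bears on [IUTchIII] Cor. 3.12 or
asserts that abc is proved or refuted; typed ≠ inhabited ≠ proved.
-/

noncomputable section

namespace Literature.AnabelianGeometry.EtaleTheta

open Topology
open Literature.AnabelianGeometry.SemiGraphs

variable {p : ℕ} [Fact p.Prime]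

namespace ThetaSetting

variable (D : ThetaSetting p)

/-! ### §1. The images of `Π^tp_Ÿ` in `(Π^tp_X)^Θ` and in `Π_X` (reading (a): closures) -/

/-- `(Π^tp_Ÿ)^Θ ⊆ (Π^tp_X)^Θ`, the image of `Π^tp_Ÿ` in the tempered theta quotient (p. 12 "`Π^tp_Y ↠ (Π^tp_Y)^Θ`",
here for `Ÿ` of p. 17; cf. the tree's `GtpYTheta`). [cite: MochizukiEtTh2009, §1 p.12] -/
def GtpYddTheta : Subgroup D.GtpTheta := D.GtpYdd.map D.toTheta

/-- `Π_{Y^∧} ⊆ Π_X`: "the profinite étale covering determined by the tempered covering `Y^log → X^log` [so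
`Π_X/Π_{Y^∧} ≅ Ẑ`]" (Rmk. 1.6.4, p. 26) — the CLOSURE of `toHat(Π^tp_Y)` in `Π_X` (reading (a) of record, R1227).
[cite: MochizukiEtTh2009, Rmk 1.6.4 p.26] -/
def GtpYHat : Subgroup D.PiHat := (D.GtpY.map D.toHat.toMonoidHom).topologicalClosure

/-- `Π_{Ÿ^∧} ⊆ Π_X`: "the profinite étale covering determined by the tempered covering `Ÿ^log → Y^log → X^log`"
(Rmk. 1.6.4, p. 26) — the CLOSURE of `toHat(Π^tp_Ÿ)` in `Π_X` (reading (a) of record, R1227).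
[cite: MochizukiEtTh2009, Rmk 1.6.4 p.26] -/
def GtpYddHat : Subgroup D.PiHat := (D.GtpYdd.map D.toHat.toMonoidHom).topologicalClosure

/-- `toHat(Π^tp_Ÿ) ⊆ Π_{Ÿ^∧}`. [cite: MochizukiEtTh2009, Rmk 1.6.4 p.26] -/
theorem map_toHat_gtpYdd_le_gtpYddHat : D.GtpYdd.map D.toHat.toMonoidHom ≤ D.GtpYddHat :=
  Subgroup.le_topologicalClosure _

/-- `Π_{Ÿ^∧} ⊆ Π_{Y^∧}` (`Ÿ → Y`, p. 17). [cite: MochizukiEtTh2009, Rmk 1.6.4 p.26] -/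
theorem gtpYddHat_le_gtpYHat : D.GtpYddHat ≤ D.GtpYHat :=
  Subgroup.topologicalClosure_mono (Subgroup.map_mono D.GtpYdd_le_GtpY)

/-- `Π_{Ÿ^∧}` is closed in `Π_X`. [cite: MochizukiEtTh2009, Rmk 1.6.4 p.26] -/
theorem isClosed_gtpYddHat : IsClosed (D.GtpYddHat : Set D.PiHat) :=
  Subgroup.isClosed_topologicalClosure _

/-! ### §2. The record: the profinite theta quotient -/

/-- **The profinite theta quotient of a theta setting** ([EtTh] §1 p. 12: "`Π_X = (Π^tp_X)^∧`",
"`Δ^Θ_X = Δ_X/[Δ_X,[Δ_X,Δ_X]]`", "`(Ẑ(1) ≅) Δ_Θ ⊆ Δ^Θ_X`"; Rmk. 1.6.4 p. 26: "[easier] profinite versions of the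
constructions given in the present §1"): a profinite group `GhatTheta = ((Π^tp_X)^Θ)^∧` receiving `Π_X` with kernel
`[Δ_X,[Δ_X,Δ_X]]⁻` and `(Π^tp_X)^Θ` as a profinite completion, compatibly with `toHat` and `toTheta` (whence `toThetaHat`
onto and `ι` injective, PROVED), in which the image of `Δ_Θ` is closed — the group through which `Π_X` (hence `Π_{Ÿ^∧}`) acts on the coefficients `Δ_Θ` of
`H¹(Π_{Ÿ^∧}, Δ_Θ)`.  A successor RECORD (hypothesis data), asserted for no datum.
[cite: MochizukiEtTh2009, §1 p.12] -/
structure HatTheta (D : ThetaSetting p) : Type 1 where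
  /-- `((Π^tp_X)^Θ)^∧`, the profinite theta quotient (p. 12 "the `∧` denotes the profinite completion"), a
  profinite group. -/
  GhatTheta : ProfiniteGrp.{0}
  /-- `Π_X ↠ ((Π^tp_X)^Θ)^∧`, the quotient of `Π_X = (Π^tp_X)^∧` "induced by the quotient `Δ_X ↠ Δ^Θ_X`" (p. 12)
  (it is onto: `toThetaHat_surjective`, PROVED below) … -/
  toThetaHat : D.PiHat →ₜ* GhatTheta
  /-- … whose kernel is print's `[Δ_X, [Δ_X, Δ_X]]⁻ ⊆ Π_X` ("`Δ^Θ_X = Δ_X/[Δ_X,[Δ_X,Δ_X]]`", p. 12) — the closed normal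
  subgroup whose pull-back along `toHat` is `Ker(Π^tp_X ↠ (Π^tp_X)^Θ)` (the frozen field `ThetaSetting.ker_toTheta`). -/
  ker_toThetaHat : toThetaHat.toMonoidHom.ker = (⁅⁅D.DeltaHat, D.DeltaHat⁆, D.DeltaHat⁆).topologicalClosure
  /-- `(Π^tp_X)^Θ → ((Π^tp_X)^Θ)^∧`, the map to the profinite completion (p. 12; injective: `ι_injective`, PROVED
  below) … -/
  ι : D.GtpTheta →ₜ* GhatTheta
  /-- … which IS a profinite completion in the sense of [SemiAnbd] §6 (abc-iut-L3's `IsProfiniteCompletion`: dense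
  image, open normal finite-index subgroups pulled back; "the `∧` denotes the profinite completion", p. 12). -/
  isProfiniteCompletion_ι : IsProfiniteCompletion ι
  /-- The square `ι ∘ toTheta = toThetaHat ∘ toHat` on `Π^tp_X` ("the quotients whose kernels are the kernels of
  the quotients `Δ^tp_X ↠ (Δ^tp_X)^Θ`", "induced by the quotients `Δ_X ↠ Δ^Θ_X`", p. 12). -/
  ι_toTheta : ∀ g : D.PiTemp, ι (D.toTheta g) = toThetaHat (D.toHat g)
  /-- `ι(Δ_Θ)` is closed in `((Π^tp_X)^Θ)^∧` ("`(Ẑ(1) ≅) Δ_Θ`", p. 12: `Δ_Θ` is already profinite). -/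
  isClosed_map_deltaTheta : IsClosed ((D.DeltaTheta.map ι.toMonoidHom : Subgroup GhatTheta) : Set GhatTheta)

namespace HatTheta

variable {D} (T : D.HatTheta)

/-! ### §2b. First consequences of the record -/

/-- The pull-back of `Ker(Π_X ↠ ((Π^tp_X)^Θ)^∧)` along `toHat` is `Ker(Π^tp_X ↠ (Π^tp_X)^Θ)` (the fields
`ker_toThetaHat` and `ThetaSetting.ker_toTheta`). [cite: MochizukiEtTh2009, §1 p.12] -/
theorem comap_toHat_ker_toThetaHat :
    T.toThetaHat.toMonoidHom.ker.comap D.toHat.toMonoidHom = D.toTheta.ker := by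
  rw [T.ker_toThetaHat, D.ker_toTheta]

/-- `ι : (Π^tp_X)^Θ → ((Π^tp_X)^Θ)^∧` is INJECTIVE — PROVED from the square and the two kernel fields
(`(Π^tp_X)^Θ = Π^tp_X/toHat⁻¹([Δ_X,[Δ_X,Δ_X]]⁻)` embeds in `Π_X/[Δ_X,[Δ_X,Δ_X]]⁻`, p. 12).
[cite: MochizukiEtTh2009, §1 p.12] -/
theorem ι_injective : Function.Injective T.ι := by
  intro g₁ g₂ h
  rw [← inv_mul_eq_one]
  set g := g₁⁻¹ * g₂ with hgdef
  have hg : T.ι g = 1 := by rw [hgdef, map_mul, map_inv, h, inv_mul_cancel]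
  clear_value g
  obtain ⟨x, rfl⟩ := D.toTheta_surjective g
  have hx : x ∈ T.toThetaHat.toMonoidHom.ker.comap D.toHat.toMonoidHom := by
    rw [Subgroup.mem_comap, MonoidHom.mem_ker]
    change T.toThetaHat (D.toHat x) = 1
    rw [← T.ι_toTheta]; exact hg
  rw [T.comap_toHat_ker_toThetaHat, MonoidHom.mem_ker] at hx
  exact hx

/-- `toThetaHat : Π_X → ((Π^tp_X)^Θ)^∧` is SURJECTIVE — PROVED: its image is compact (`Π_X` is compact, being the
profinite completion of `Π^tp_X`) hence closed, and contains the dense subgroup `ι((Π^tp_X)^Θ) = toThetaHat(toHat(Π^tp_X))`.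
[cite: MochizukiEtTh2009, §1 p.12] -/
theorem toThetaHat_surjective : Function.Surjective T.toThetaHat := by
  haveI : CompactSpace D.PiHat := D.isProfiniteCompletion_toHat.compactSpace
  have hcl : IsClosed (Set.range T.toThetaHat) := (isCompact_range T.toThetaHat.continuous).isClosed
  have hdense : Dense (Set.range T.toThetaHat) := by
    refine T.isProfiniteCompletion_ι.denseRange.mono ?_
    rintro _ ⟨g, rfl⟩
    obtain ⟨x, rfl⟩ := D.toTheta_surjective g
    exact ⟨D.toHat x, (T.ι_toTheta x).symm⟩
  intro y
  have hy : y ∈ closure (Set.range T.toThetaHat) := hdense y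
  rw [hcl.closure_eq] at hy
  exact hy


/-! ### §3. Derived objects (spec v2 §D2) -/

/-- `Δ_Θ ⊆ ((Π^tp_X)^Θ)^∧`: the image `ι(Δ_Θ)` — the coefficient group of `H¹(Π_{Ÿ^∧}, Δ_Θ)` (Rmk. 1.6.4, p. 26).
[cite: MochizukiEtTh2009, Rmk 1.6.4 p.26] -/
abbrev DeltaThetaHat : Subgroup T.GhatTheta := D.DeltaTheta.map T.ι.toMonoidHom

/-- `ι(Δ_Θ)` is closed (the field `isClosed_map_deltaTheta`). [cite: MochizukiEtTh2009, §1 p.12] -/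
theorem isClosed_deltaThetaHat : IsClosed (T.DeltaThetaHat : Set T.GhatTheta) :=
  T.isClosed_map_deltaTheta

/-- `ι(Δ_Θ)` is commutative ("`(Ẑ(1) ≅) Δ_Θ`", p. 12) — by instance from `D.DeltaTheta`; recorded as a theorem.
[cite: MochizukiEtTh2009, §1 p.12] -/
theorem deltaThetaHat_isMulCommutative : IsMulCommutative T.DeltaThetaHat := inferInstance

/-- `ι(Δ_Θ)` is NORMAL in `((Π^tp_X)^Θ)^∧`: it is closed and normalised by the dense subgroup `ι((Π^tp_X)^Θ)`
(`Δ_Θ ⊴ (Π^tp_X)^Θ`, p. 12).  A THEOREM, not a registered instance (typer lint rule): consumers write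
`haveI := T.deltaThetaHat_normal`. [cite: MochizukiEtTh2009, §1 p.12] -/
theorem deltaThetaHat_normal : T.DeltaThetaHat.Normal := by
  -- the set of elements conjugating the closed subgroup `ι(Δ_Θ)` into itself is closed …
  have hcl : IsClosed {g : T.GhatTheta | ∀ h ∈ T.DeltaThetaHat, g * h * g⁻¹ ∈ T.DeltaThetaHat} := by
    have : {g : T.GhatTheta | ∀ h ∈ T.DeltaThetaHat, g * h * g⁻¹ ∈ T.DeltaThetaHat} =
        ⋂ h : T.DeltaThetaHat, (fun g : T.GhatTheta => g * (h : T.GhatTheta) * g⁻¹) ⁻¹'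
          (T.DeltaThetaHat : Set T.GhatTheta) := by
      ext g
      simp only [Set.mem_setOf_eq, Set.mem_iInter, Set.mem_preimage, SetLike.mem_coe, Subtype.forall]
    rw [this]
    exact isClosed_iInter fun h => T.isClosed_deltaThetaHat.preimage (by fun_prop)
  -- … and contains the dense image `ι((Π^tp_X)^Θ)` (normality of `Δ_Θ` in `(Π^tp_X)^Θ`)
  have hconj : ∀ g ∈ Set.range T.ι, ∀ h ∈ T.DeltaThetaHat, g * h * g⁻¹ ∈ T.DeltaThetaHat := by
    rintro _ ⟨x, rfl⟩ _ ⟨d, hd, rfl⟩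
    refine ⟨x * d * x⁻¹, D.deltaTheta_normal.conj_mem d hd x, ?_⟩
    simp only [map_mul, map_inv]
    rfl
  have hall : ∀ g : T.GhatTheta, ∀ h ∈ T.DeltaThetaHat, g * h * g⁻¹ ∈ T.DeltaThetaHat := fun g =>
    (hcl.closure_subset_iff.2 (fun g hg => hconj g hg)) (T.isProfiniteCompletion_ι.denseRange g)
  exact ⟨fun h hh g => hall g h hh⟩

/-- `((Π^tp_Ÿ)^Θ)^∧ ⊆ ((Π^tp_X)^Θ)^∧`: the CLOSURE of `ι((Π^tp_Ÿ)^Θ)` (reading (a), at the Θ-level; spec v2 D2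
`GhatThetaYdd`). [cite: MochizukiEtTh2009, Rmk 1.6.4 p.26] -/
def GhatThetaYdd : Subgroup T.GhatTheta := (D.GtpYddTheta.map T.ι.toMonoidHom).topologicalClosure

/-- `ι((Π^tp_Ÿ)^Θ) ⊆ ((Π^tp_Ÿ)^Θ)^∧`. [cite: MochizukiEtTh2009, Rmk 1.6.4 p.26] -/
theorem map_ι_gtpYddTheta_le_ghatThetaYdd : D.GtpYddTheta.map T.ι.toMonoidHom ≤ T.GhatThetaYdd :=
  Subgroup.le_topologicalClosure _

/-- `((Π^tp_Ÿ)^Θ)^∧` is closed. [cite: MochizukiEtTh2009, Rmk 1.6.4 p.26] -/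
theorem isClosed_ghatThetaYdd : IsClosed (T.GhatThetaYdd : Set T.GhatTheta) :=
  Subgroup.isClosed_topologicalClosure _

/-- The co-restriction `ιYdd : (Π^tp_Ÿ)^Θ → ((Π^tp_Ÿ)^Θ)^∧` of `ι` (spec v2 D2; the map whose being a profinite
completion — `IsProfiniteCompletion T.ιYdd` — is the one displayed input of the Rmk. 1.6.4 comparison, D3 v2).
[cite: MochizukiEtTh2009, Rmk 1.6.4 p.26] -/
def ιYdd : D.GtpYddTheta →ₜ* T.GhatThetaYdd where
  toMonoidHom := (T.ι.toMonoidHom.comp D.GtpYddTheta.subtype).codRestrict T.GhatThetaYdd fun g =>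
    T.map_ι_gtpYddTheta_le_ghatThetaYdd ⟨g, g.2, rfl⟩
  continuous_toFun := (T.ι.continuous.comp continuous_subtype_val).subtype_mk _

/-- `ιYdd` agrees with `ι`. [cite: MochizukiEtTh2009, Rmk 1.6.4 p.26] -/
theorem ιYdd_apply (g : D.GtpYddTheta) : ((T.ιYdd g : T.GhatThetaYdd) : T.GhatTheta) = T.ι g := rfl

/-- `ιYdd` has dense image (its target is the closure of its image). [cite: MochizukiEtTh2009, Rmk 1.6.4 p.26] -/
theorem denseRange_ιYdd : DenseRange T.ιYdd := by
  have hr : Set.range T.ιYdd =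
      (Subtype.val : T.GhatThetaYdd → T.GhatTheta) ⁻¹' (T.ι '' (D.GtpYddTheta : Set D.GtpTheta)) := by
    ext w
    constructor
    · rintro ⟨u, rfl⟩
      exact ⟨u, u.2, rfl⟩
    · rintro ⟨x, hx, hxw⟩
      exact ⟨⟨x, hx⟩, Subtype.ext hxw⟩
  rw [DenseRange, hr, Subtype.dense_iff]
  intro w hw
  have hWset : (T.GhatThetaYdd : Set T.GhatTheta) = closure (T.ι '' (D.GtpYddTheta : Set D.GtpTheta)) := by
    rw [GhatThetaYdd, Subgroup.topologicalClosure_coe, Subgroup.coe_map]; rfl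
  have hw' : w ∈ closure (T.ι '' (D.GtpYddTheta : Set D.GtpTheta)) := by rw [← hWset]; exact hw
  refine closure_mono ?_ hw'
  rintro _ ⟨x, hx, rfl⟩
  exact ⟨⟨T.ι x, T.map_ι_gtpYddTheta_le_ghatThetaYdd ⟨x, hx, rfl⟩⟩, ⟨x, hx, rfl⟩, rfl⟩

/-- The square `ι ∘ toTheta = toThetaHat ∘ toHat` on subgroups: for every `H ≤ Π^tp_X`,
`toThetaHat(toHat(H)) = ι(toTheta(H))` in `((Π^tp_X)^Θ)^∧` (p. 12). [cite: MochizukiEtTh2009, §1 p.12] -/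
theorem map_toThetaHat_map_toHat (H : Subgroup D.PiTemp) :
    (H.map D.toHat.toMonoidHom).map T.toThetaHat.toMonoidHom = (H.map D.toTheta).map T.ι.toMonoidHom := by
  rw [Subgroup.map_map, Subgroup.map_map]
  congr 1
  ext g
  simp only [MonoidHom.coe_comp, Function.comp_apply, ContinuousMonoidHom.coe_toMonoidHom]
  exact (T.ι_toTheta g).symm

/-- The square at the level of `Ÿ`: `toThetaHat(Π_{Ÿ^∧}) ⊆ ((Π^tp_Ÿ)^Θ)^∧` — `toThetaHat` maps the closure of
`toHat(Π^tp_Ÿ)` into the closure of `toThetaHat(toHat(Π^tp_Ÿ)) = ι(toTheta(Π^tp_Ÿ))` by continuity and the square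
`ι_toTheta`. [cite: MochizukiEtTh2009, Rmk 1.6.4 p.26] -/
theorem map_toThetaHat_gtpYddHat_le :
    D.GtpYddHat.map T.toThetaHat.toMonoidHom ≤ T.GhatThetaYdd := by
  rw [GhatThetaYdd, GtpYddTheta, ← T.map_toThetaHat_map_toHat]
  intro y hy
  obtain ⟨x, hx, rfl⟩ := hy
  have hx' : x ∈ closure ((D.GtpYdd.map D.toHat.toMonoidHom : Subgroup D.PiHat) : Set D.PiHat) := by
    rw [← Subgroup.topologicalClosure_coe]; exact hx
  have h1 : T.toThetaHat.toMonoidHom x ∈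
      closure (T.toThetaHat '' ((D.GtpYdd.map D.toHat.toMonoidHom : Subgroup D.PiHat) : Set D.PiHat)) :=
    image_closure_subset_closure_image T.toThetaHat.continuous ⟨x, hx', rfl⟩
  have h2 : T.toThetaHat '' ((D.GtpYdd.map D.toHat.toMonoidHom : Subgroup D.PiHat) : Set D.PiHat) =
      (((D.GtpYdd.map D.toHat.toMonoidHom).map T.toThetaHat.toMonoidHom : Subgroup T.GhatTheta) :
        Set T.GhatTheta) := by
    rw [Subgroup.coe_map]; rfl
  rw [h2, ← Subgroup.topologicalClosure_coe] at h1
  exact h1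

/-! ### §4. The profinite cohomology groups of Remark 1.6.4 (spec v2 §D2), over abc-iut-L2-t5's `ContH1` -/

/-- `H¹(H′, Δ_Θ)` for a subgroup `H′ ≤ ((Π^tp_X)^Θ)^∧` — e.g. `((Π^tp_Ÿ)^Θ)^∧` — with `((Π^tp_X)^Θ)^∧` acting on
`ι(Δ_Θ)` by conjugation (the profinite twin of the tree's `ThetaSetting.H1Theta`).  The normality instance is taken
as an argument (`haveI := T.deltaThetaHat_normal` supplies it; no instance is registered in this file).
[cite: MochizukiEtTh2009, Rmk 1.6.4 p.26] -/
abbrev H1ThetaHat [T.DeltaThetaHat.Normal] (H' : Subgroup T.GhatTheta) : Type :=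
  ContH1 (MonoidHom.id T.GhatTheta) T.DeltaThetaHat H'

/-- `H¹(H, Δ_Θ)` for a subgroup `H ≤ Π_X` — e.g. "`H¹(Π_{Ÿ^∧}, Δ_Θ)`" (Rmk. 1.6.4, p. 26) — with `Π_X` acting on `ι(Δ_Θ)` by
conjugation through `toThetaHat : Π_X ↠ ((Π^tp_X)^Θ)^∧` (the profinite twin of the tree's `ThetaSetting.H1`).
[cite: MochizukiEtTh2009, Rmk 1.6.4 p.26] -/
abbrev H1Hat [T.DeltaThetaHat.Normal] (H : Subgroup D.PiHat) : Type :=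
  ContH1 T.toThetaHat.toMonoidHom T.DeltaThetaHat H

/-- Inflation `H¹(((Π^tp_Ÿ)^Θ)^∧, Δ_Θ) → H¹(Π_{Ÿ^∧}, Δ_Θ)` along `toThetaHat|Π_{Ÿ^∧}` (the profinite twin of the tree's
`ThetaSetting.inflTheta`; well defined by `map_toThetaHat_gtpYddHat_le`). [cite: MochizukiEtTh2009, Rmk 1.6.4 p.26] -/
def inflThetaHat [T.DeltaThetaHat.Normal] : T.H1ThetaHat T.GhatThetaYdd →* T.H1Hat D.GtpYddHat :=
  ContH1.infl T.DeltaThetaHat T.toThetaHat.toMonoidHom T.toThetaHat.continuous T.map_toThetaHat_gtpYddHat_le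

/-- Consumer certificate (kernel): with `haveI := T.deltaThetaHat_normal` in scope the profinite cohomology groups of
Remark 1.6.4 are abelian groups by abc-iut-L2-t5's `ContH1` instance and the inflation `inflThetaHat` is available —
nothing is registered as an instance in this file. [cite: MochizukiEtTh2009, Rmk 1.6.4 p.26] -/
example (T : D.HatTheta) : True := by
  haveI := T.deltaThetaHat_normal
  let _i : CommGroup (T.H1Hat D.GtpYddHat) := inferInstance
  let _j : CommGroup (T.H1ThetaHat T.GhatThetaYdd) := inferInstance
  let _f : T.H1ThetaHat T.GhatThetaYdd →* T.H1Hat D.GtpYddHat := T.inflThetaHat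
  trivial

end HatTheta

end ThetaSetting

end Literature.AnabelianGeometry.EtaleTheta

end
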